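import Literature.AnabelianGeometry.EtaleTheta.Discharge.Sec2DiscreteNormalizersTempered
import Literature.IUT.HodgeTheaters.DiscreteProfiniteConjugatesFreeGroupLemmas
import Mathlib.GroupTheory.FreeGroup.CyclicallyReduced

/-!
# [EtTh] Lemma 2.17 (ii) for open subgroups of FINITE index: an `H`-independent tower input

Mochizuki, *The Étale Theta Function and its Frobenioid-theoretic Manifestations* [EtTh],
Publ. RIMS 45 (2009), §2, Lemma 2.17 (ii), PRIMS text pp.58–59 (printed pp.284–285; bib key
`MochizukiEtTh2009`).  PROOF-ONLY companion of `Sec2DiscreteNormalizersTempered.lean` (no definitions):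
for an open subgroup `H ⊆ Π` OF FINITE INDEX the anabelian input of
`normalizer_map_eq_of_isTempered` reduces to an `H`-independent statement about `Π` alone —
"quotients of `Π` by characteristic open subgroups of `Π` … contain finite rank free normal subgroups
of finite index" (p.59) which are NON-ABELIAN, cofinally (`htower₀` below): the non-abelianness of
`(H/N) ∩ G` is then automatic, because a finite-index subgroup of a non-abelian free group is
non-abelian (`exists_not_commute_of_finiteIndex`, from the cyclicity of centralizers in free groups,
tree `FreeOrSurface.exists_centralizer_eq_zpowers`, [IUTchI] Lem. 2.7 (iv)).

Honest framing: classical group theory; nothing here concerns [IUTchIII] Cor. 3.12; typed ≠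
discharged — Lemma 2.17 (ii) for finite-index `H` is discharged here MODULO `h217i` and `htower₀`.
-/

namespace Literature.AnabelianGeometry.EtaleTheta.DiscreteNormalizers

open CategoryTheory ProfiniteGrp ProfiniteGrp.ProfiniteCompletion Topology
open Literature.AnabelianGeometry.SemiGraphs

universe u v

/-- Free groups (in the sense of `IsFreeGroup`) are torsion-free: `a ^ m = 1`, `m ≠ 0` forces
`a = 1` (Mathlib's `IsMulTorsionFree (FreeGroup _)`, transported along `IsFreeGroup.toFreeGroup`).
[cite: MochizukiEtTh2009, Lem 2.17(ii) p.59] -/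
theorem eq_one_of_pow_eq_one_of_isFreeGroup {G : Type*} [Group G] [IsFreeGroup G] {a : G} {m : ℕ}
    (hm : m ≠ 0) (h : a ^ m = 1) : a = 1 := by
  have h1 : (IsFreeGroup.toFreeGroup G a) ^ m = 1 := by rw [← map_pow, h, map_one]
  have h2 : IsFreeGroup.toFreeGroup G a = 1 := (pow_eq_one_iff_left hm).mp h1
  exact (IsFreeGroup.toFreeGroup G).injective (h2.trans (map_one _).symm)

/-- In a free group, if `a ^ m` commutes with `c` for some `m ≠ 0` and `a ≠ 1`, then `a` commutes
with `c` (centralizers of non-trivial elements are cyclic, tree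
`FreeOrSurface.exists_centralizer_eq_zpowers`). [cite: MochizukiEtTh2009, Lem 2.17(ii) p.59] -/
theorem commute_of_pow_commute_of_isFreeGroup {G : Type u} [Group G] [IsFreeGroup G] {a c : G}
    {m : ℕ} (hm : m ≠ 0) (ha : a ≠ 1) (h : a ^ m * c = c * a ^ m) : a * c = c * a := by
  have ham : a ^ m ≠ 1 := fun h' => ha (eq_one_of_pow_eq_one_of_isFreeGroup hm h')
  obtain ⟨r, hr⟩ := Literature.IUT.HodgeTheaters.FreeOrSurface.exists_centralizer_eq_zpowers G
    (a ^ m) ham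
  have haC : a ∈ Subgroup.centralizer ({a ^ m} : Set G) := by
    rw [Subgroup.mem_centralizer_iff]
    intro x hx
    rw [Set.mem_singleton_iff] at hx
    rw [hx, ← pow_succ, ← pow_succ']
  have hcC : c ∈ Subgroup.centralizer ({a ^ m} : Set G) := by
    rw [Subgroup.mem_centralizer_iff]
    intro x hx
    rw [Set.mem_singleton_iff] at hx
    rw [hx, h]
  rw [hr] at haC hcC
  obtain ⟨i, rfl⟩ := Subgroup.mem_zpowers_iff.mp haC
  obtain ⟨j, rfl⟩ := Subgroup.mem_zpowers_iff.mp hcC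
  rw [← zpow_add, ← zpow_add, add_comm]

/-- **A finite-index subgroup of a non-abelian free group is non-abelian.**  If `G` is free and
`a, b ∈ G` do not commute, every subgroup `K ≤ G` of finite index contains two non-commuting
elements (namely suitable powers of `a` and `b`). [cite: MochizukiEtTh2009, Lem 2.17(ii) p.59] -/
theorem exists_not_commute_of_finiteIndex {G : Type u} [Group G] [IsFreeGroup G] {a b : G}
    (hab : a * b ≠ b * a) (K : Subgroup G) [K.FiniteIndex] :
    ∃ x ∈ K, ∃ y ∈ K, x * y ≠ y * x := by
  have ha : a ≠ 1 := by rintro rfl; simp at hab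
  have hb : b ≠ 1 := by rintro rfl; simp at hab
  let m : ℕ := K.normalCore.index
  have hm : m ≠ 0 := Subgroup.FiniteIndex.index_ne_zero
  refine ⟨a ^ m, K.normalCore_le (K.normalCore.pow_index_mem a), b ^ m,
    K.normalCore_le (K.normalCore.pow_index_mem b), fun h => hab ?_⟩
  -- `a^m` commutes with `b^m` ⇒ `a` commutes with `b^m` ⇒ `b` commutes with `a`
  have h1 : a * b ^ m = b ^ m * a := commute_of_pow_commute_of_isFreeGroup hm ha h
  have h2 : b * a = a * b := commute_of_pow_commute_of_isFreeGroup hm hb h1.symm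
  exact h2.symm

/-- **[EtTh] Lemma 2.17 (ii) for open subgroups of finite index**, with an `H`-INDEPENDENT anabelian
input: if the tempered group `Π` has cofinally many open normal subgroups `N` such that `Π/N`
contains a NON-ABELIAN free normal subgroup of finite index and finite rank (`htower₀` — "quotients
of `Π` by characteristic open subgroups of `Π`, which contain finite rank free normal subgroups of
finite index", p.59), then for every open `H ⊆ Π` of finite index `N_{Π̂}(ι H) = ι(N_Π(H))`
(given Lemma 2.17 (i) as `h217i`).  Reduction to `normalizer_map_eq_of_isTempered`: `H ∩ N`-saturation
is automatic (`H` is a neighbourhood of `1`), and `(H/N) ∩ G` has finite index in the non-abelian free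
group `G`, hence is non-abelian (`exists_not_commute_of_finiteIndex`).
[cite: MochizukiEtTh2009, Lem 2.17(ii) pp.58–59] -/
theorem normalizer_map_eq_of_isTempered_of_finiteIndex
    {P : Type u} [Group P] [TopologicalSpace P] [IsTopologicalGroup P]
    {Ph : Type v} [Group Ph] [TopologicalSpace Ph] [IsTopologicalGroup Ph]
    (h217i : ∀ (F : Type u) [Group F] (G H : Subgroup F) [IsFreeGroup G], G.Normal → G.FiniteIndex →
      Finite (IsFreeGroup.Generators G) → (∃ a ∈ H ⊓ G, ∃ b ∈ H ⊓ G, a * b ≠ b * a) →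
      let η : F →* ProfiniteGrp.ProfiniteCompletion.completion (GrpCat.of F) :=
        (ProfiniteGrp.ProfiniteCompletion.eta (GrpCat.of F)).hom
      Subgroup.normalizer ((H.map η : Subgroup _) : Set _) =
        (Subgroup.normalizer (H : Set F)).map η)
    (hP : IsTempered P) (ι : P →ₜ* Ph) (hι : IsProfiniteCompletion ι) (H : Subgroup P)
    (hH : IsOpen (H : Set P)) [H.FiniteIndex]
    (htower₀ : ∀ U ∈ 𝓝 (1 : P), ∃ N : OpenNormalSubgroup P, (N : Set P) ⊆ U ∧
      ∃ (G : Subgroup (P ⧸ N.toSubgroup)) (_ : IsFreeGroup G), G.Normal ∧ G.FiniteIndex ∧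
        Finite (IsFreeGroup.Generators G) ∧ ∃ a ∈ G, ∃ b ∈ G, a * b ≠ b * a) :
    Subgroup.normalizer ((H.map ι.toMonoidHom : Subgroup Ph) : Set Ph) =
      (Subgroup.normalizer (H : Set P)).map ι.toMonoidHom := by
  refine normalizer_map_eq_of_isTempered h217i hP ι hι H ?_
  intro U hU
  -- shrink inside `H` (an open subgroup is a neighbourhood of `1`)
  have hHU : (H : Set P) ∩ U ∈ 𝓝 (1 : P) := Filter.inter_mem (hH.mem_nhds H.one_mem) hU
  obtain ⟨N, hNU, G, hG, hGn, hGfi, hGfin, a, ha, b, hb, hab⟩ := htower₀ _ hHU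
  haveI := hG
  haveI := hGfi
  refine ⟨N, fun x hx => (hNU hx).2, fun x hx => (hNU hx).1, G, hG, hGn, hGfi, hGfin, ?_⟩
  -- `(H/N) ∩ G` has finite index in the free group `G` containing the non-commuting `a, b`
  haveI : (H.map (QuotientGroup.mk' N.toSubgroup)).FiniteIndex := by
    rw [Subgroup.finiteIndex_iff]
    exact ne_zero_of_dvd_ne_zero Subgroup.FiniteIndex.index_ne_zero
      (Subgroup.index_map_dvd _ (QuotientGroup.mk'_surjective N.toSubgroup))
  have hab' : (⟨a, ha⟩ : G) * ⟨b, hb⟩ ≠ ⟨b, hb⟩ * ⟨a, ha⟩ := fun h =>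
    hab (by simpa using congrArg Subtype.val h)
  obtain ⟨x, hx, y, hy, hxy⟩ := exists_not_commute_of_finiteIndex hab'
    ((H.map (QuotientGroup.mk' N.toSubgroup)).subgroupOf G)
  exact ⟨x, Subgroup.mem_inf.mpr ⟨Subgroup.mem_subgroupOf.mp hx, x.2⟩, y,
    Subgroup.mem_inf.mpr ⟨Subgroup.mem_subgroupOf.mp hy, y.2⟩,
    fun h => hxy (Subtype.ext h)⟩

end Literature.AnabelianGeometry.EtaleTheta.DiscreteNormalizers
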